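import Literature.NumberTheory.Transcendental.JungBaseChart
import Literature.NumberTheory.Transcendental.JungRootStructure
import Literature.NumberTheory.Transcendental.JungRootDifferences
import Literature.NumberTheory.Transcendental.JungSlabCover
import Literature.NumberTheory.Transcendental.JungSlabCharts
import Literature.NumberTheory.Transcendental.JungChartFactorClause
import Literature.NumberTheory.Transcendental.SlabChartsMeasure
import HarnessLib

/-!
# Jung's projection method: the slab charts over one prepared base chart (the chart package)

Assembly, over ONE base chart `φ` of the base `ℝᵈ` (output of the cube-monomialisation `E(d)`
applied to the discriminant `D = Res(P, P')`) and one dyadic corner `c`, of the sheared slab charts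
of Jung's method for a bounded `ℚ`-semialgebraic `B ⊆ ℝᵈ⁺¹` presented by sign conditions:
`exists_chart_package` produces the ramified chart `χ = φ ∘ ψ_c ∘ (·)^N`, finitely many FORMAT charts
`Ψ_a` of `ℝᵈ⁺¹` with open-cube images inside `B`, pairwise disjoint, contained in the sheared
cylinder over `χ((0,1)ᵈ)` and covering `B` over that cylinder up to a null set (the wall graphs),
and along each of which every `Q_j` is in the binomial product form of the skeleton's `PREP(d)`.
The Abhyankar–Jung theorem and the divisor lemma enter as the hypotheses `hAJ`, `hDIV` (verbatim
from the cube-monomialisation skeleton). Everything is a composition of the files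
`JungBaseChart`, `JungRootStructure`, `JungRootDifferences`, `JungSlabCharts`, `JungSlabCover`,
`JungChartFactorClause` (namespace `Literature.NumberTheory.Transcendental.JungPreparation`).

## References

* H. W. E. Jung, J. reine angew. Math. 133 (1908); J. Kollár, *Lectures on Resolution of
  Singularities* (2007), §2.3; S. Basu, R. Pollack, M.-F. Roy, *Algorithms in Real Algebraic
  Geometry* (2006), §5.1.
-/

noncomputable section

open Set Polynomial MeasureTheory
open scoped ComplexConjugate
open Literature.ModelTheory.ExponentialFields
open Literature.ModelTheory.ExponentialFields.CylindricalDecomposition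
open Literature.Analysis.Calculus

namespace Literature.NumberTheory.Transcendental.JungPreparation

variable {d : ℕ}

/-- The last-variable form `P ∈ ℚ[x][T]` comes from a polynomial `q ∈ ℚ[x_0, …, x_d]` with
`q(z) = P(z', z_d)`. [folklore] -/
theorem exists_mvPolynomial_of_polynomial (P : (MvPolynomial (Fin d) ℚ)[X]) :
    ∃ q : MvPolynomial (Fin (d + 1)) ℚ, ∀ z : Fin (d + 1) → ℝ, MvPolynomial.aeval z q =
      (P.map (MvPolynomial.eval₂Hom (algebraMap ℚ ℝ) (Fin.init z))).eval (z (Fin.last d)) := by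
  refine ⟨MvPolynomial.rename (finRotate (d + 1)).symm ((MvPolynomial.finSuccEquiv ℚ d).symm P),
    fun z => ?_⟩
  rw [← eval_map_finSuccEquiv_rename_finRotate, MvPolynomial.rename_rename]
  simp only [Equiv.self_comp_symm, MvPolynomial.rename_id, AlgHom.id_apply, AlgEquiv.apply_symm_apply]

/-- Real roots of `P(χ(σ), ·)` along the factorisation `P(χ(σ), T) = ∏ (T − ζ_l(σ))`. [folklore] -/
theorem eval_map_eq_zero_iff {n : ℕ} {P : (MvPolynomial (Fin d) ℚ)[X]} {x : Fin d → ℝ}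
    {ζ : Fin n → ℂ}
    (hfac : P.map ((algebraMap ℝ ℂ).comp (MvPolynomial.eval₂Hom (algebraMap ℚ ℝ) x)) = ∏ l, (X - C (ζ l)))
    (t : ℝ) :
    (P.map (MvPolynomial.eval₂Hom (algebraMap ℚ ℝ) x)).eval t = 0 ↔ ∃ l, (t : ℂ) = ζ l := by
  rw [← Complex.ofReal_eq_zero, ofReal_eval_map, hfac, eval_prod, Finset.prod_eq_zero_iff]
  simp [sub_eq_zero]

/-- **The chart package over one prepared base chart.** See the module docstring (Jung 1908;
Kollár 2007, §2.3; Basu–Pollack–Roy 2006, §5.1), with Abhyankar–Jung (`hAJ`) and the divisor lemma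
(`hDIV`) as hypotheses. [folklore] -/
theorem exists_chart_package
    (hAJ : ∀ (n : ℕ) (U : Set (Fin d → ℝ)), IsOpen U →
      Set.pi Set.univ (fun _ : Fin d => Set.Icc (0:ℝ) 1) ⊆ U →
      ∀ (a : Fin n → (Fin d → ℝ) → ℝ) (α : Fin d → ℕ) (e : (Fin d → ℝ) → ℝ),
      (∀ k, AnalyticOnNhd ℝ (a k) U) → AnalyticOnNhd ℝ e U → (∀ x ∈ U, e x ≠ 0) →
      (∀ x ∈ U, Polynomial.resultant (Polynomial.X ^ n + ∑ k : Fin n, Polynomial.C (a k (x)) *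
        Polynomial.X ^ (k : ℕ)) (Polynomial.derivative (Polynomial.X ^ n + ∑ k : Fin n,
        Polynomial.C (a k (x)) * Polynomial.X ^ (k : ℕ))) = (∏ i, x i ^ α i) * e x) →
      ∃ N : ℕ, 0 < N ∧ ∃ V : Set (Fin d → ℝ), IsOpen V ∧
        Set.pi Set.univ (fun _ : Fin d => Set.Icc (0:ℝ) 1) ⊆ V ∧ (∀ σ ∈ V, (fun i => σ i ^ N) ∈ U) ∧
        ∃ ζ : Fin n → (Fin d → ℝ) → ℂ, (∀ l, AnalyticOnNhd ℝ (ζ l) V) ∧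
        ∀ σ ∈ V, ((Polynomial.X ^ n + ∑ k : Fin n, Polynomial.C (a k (fun i => σ i ^ N)) *
          Polynomial.X ^ (k : ℕ))).map (algebraMap ℝ ℂ) = ∏ l, (Polynomial.X - Polynomial.C (ζ l σ)))
    (hDIV : ∀ (U : Set (Fin d → ℝ)), IsOpen U → Set.pi Set.univ (fun _ : Fin d => Set.Icc (0:ℝ) 1) ⊆ U →
      ∀ (f g e : (Fin d → ℝ) → ℂ) (a : Fin d → ℕ), AnalyticOnNhd ℝ f U → AnalyticOnNhd ℝ g U →
      AnalyticOnNhd ℝ e U → (∀ x ∈ U, e x ≠ 0) →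
      (∀ x ∈ U, f x * g x = (∏ i, ((x i : ℝ) : ℂ) ^ a i) * e x) →
      ∃ (b : Fin d → ℕ) (V : Set (Fin d → ℝ)) (u : (Fin d → ℝ) → ℂ), IsOpen V ∧
        Set.pi Set.univ (fun _ : Fin d => Set.Icc (0:ℝ) 1) ⊆ V ∧ V ⊆ U ∧ AnalyticOnNhd ℝ u V ∧
        (∀ x ∈ V, u x ≠ 0) ∧ (∀ i, b i ≤ a i) ∧ ∀ x ∈ V, f x = (∏ i, ((x i : ℝ) : ℂ) ^ b i) * u x)
    {k : ℕ} (Q : Fin k → MvPolynomial (Fin (d + 1)) ℚ)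
    {Ps : Finset (MvPolynomial (Fin (d + 1)) ℚ)} {T : Set (Ps → SignType)} {B : Set (Fin (d + 1) → ℝ)}
    (hB : B = {x | (fun q : Ps => SignType.sign (MvPolynomial.aeval x (q : MvPolynomial (Fin (d + 1)) ℚ))) ∈ T})
    (v : Fin d → ℚ) (Sh : (Fin (d + 1) → ℝ) → (Fin (d + 1) → ℝ))
    (hSh : ∀ z, Sh z = Fin.snoc (fun i : Fin d => z (Fin.castSucc i) + algebraMap ℚ ℝ (v i) * z (Fin.last d))
      (z (Fin.last d)))
    (hbdd : Bornology.IsBounded {z | Sh z ∈ B})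
    {Rh P M : (MvPolynomial (Fin d) ℚ)[X]} (hRh : Rh.Monic) (hP : P.Monic) {n : ℕ} (hn : P.natDegree = n)
    (hM : M = (Rh.map C).resultant ((Rh.map C).comp (C (2 * X) - X)) Rh.natDegree Rh.natDegree)
    {κM : ℚ} {mM : ℕ} (hMP : C (MvPolynomial.C κM) * M ∣ P ^ mM)
    {D : MvPolynomial (Fin d) ℚ} (hD : D = P.resultant (derivative P) n (n - 1))
    (Qh : Fin k → (MvPolynomial (Fin d) ℚ)[X]) (hQh : ∀ j, (Qh j).Monic ∧ Qh j ∣ Rh)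
    (κ : Fin k → ℚ) (hκ : ∀ j, κ j ≠ 0)
    (hQeval : ∀ j (y : Fin (d + 1) → ℝ), MvPolynomial.aeval (Sh y) (Q j) = algebraMap ℚ ℝ (κ j) *
      ((Qh j).map (MvPolynomial.eval₂Hom (algebraMap ℚ ℝ) (Fin.init y))).eval (y (Fin.last d)))
    (Ph : Ps → (MvPolynomial (Fin d) ℚ)[X]) (κ' : Ps → ℚ)
    (hPh : ∀ q : Ps, (q : MvPolynomial (Fin (d + 1)) ℚ) ≠ 0 → κ' q ≠ 0 ∧ (Ph q).Monic ∧ Ph q ∣ Rh)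
    (hPeval : ∀ (q : Ps) (y : Fin (d + 1) → ℝ), (q : MvPolynomial (Fin (d + 1)) ℚ) ≠ 0 →
      MvPolynomial.aeval (Sh y) (q : MvPolynomial (Fin (d + 1)) ℚ) = algebraMap ℚ ℝ (κ' q) *
        ((Ph q).map (MvPolynomial.eval₂Hom (algebraMap ℚ ℝ) (Fin.init y))).eval (y (Fin.last d)))
    (φ : (Fin d → ℝ) → (Fin d → ℝ))
    (hφa : AnalyticOnNhd ℝ φ (Set.pi Set.univ (fun _ : Fin d => Icc (0 : ℝ) 1)))
    (hφs : IsSemialgebraicMapOn ℚ (Set.pi Set.univ (fun _ : Fin d => Ioo (0 : ℝ) 1)) φ)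
    (hφi : InjOn φ (Set.pi Set.univ (fun _ : Fin d => Ioo (0 : ℝ) 1)))
    (hφd : ∀ x ∈ Set.pi Set.univ (fun _ : Fin d => Ioo (0 : ℝ) 1), (fderiv ℝ φ x).det ≠ 0)
    {U₀ : Set (Fin d → ℝ)} (hU₀ : IsOpen U₀)
    (hcubeU₀ : Set.pi Set.univ (fun _ : Fin d => Icc (0 : ℝ) 1) ⊆ U₀) (a b : Fin d → ℕ)
    {e₀ : (Fin d → ℝ) → ℝ} (he₀ : AnalyticOnNhd ℝ e₀ U₀) (he₀0 : ∀ x ∈ U₀, e₀ x ≠ 0)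
    (hDφ : ∀ x ∈ U₀, MvPolynomial.aeval (φ x) D = (∏ i, x i ^ a i * (1 - x i) ^ b i) * e₀ x)
    (c : Fin d → Bool) :
    ∃ (N : ℕ) (χ : (Fin d → ℝ) → (Fin d → ℝ)) (Nc : ℕ) (Ψ : Fin Nc → (Fin (d + 1) → ℝ) → (Fin (d + 1) → ℝ))
      (Nz : Set (Fin (d + 1) → ℝ)),
      0 < N ∧ (∀ σ, χ σ = φ (fun i => if c i then 1 - σ i ^ N / 2 else σ i ^ N / 2)) ∧
      InjOn χ (Set.pi Set.univ (fun _ : Fin d => Ioo (0 : ℝ) 1)) ∧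
      (∀ i, (AnalyticOnNhd ℝ (Ψ i) (Set.pi Set.univ (fun _ : Fin (d + 1) => Set.Icc (0:ℝ) 1)) ∧
        IsSemialgebraicMapOn ℚ (Set.pi Set.univ (fun _ : Fin (d + 1) => Set.Ioo (0:ℝ) 1)) (Ψ i) ∧
        Set.InjOn (Ψ i) (Set.pi Set.univ (fun _ : Fin (d + 1) => Set.Ioo (0:ℝ) 1)) ∧
        ∀ x ∈ Set.pi Set.univ (fun _ : Fin (d + 1) => Set.Ioo (0:ℝ) 1), (fderiv ℝ (Ψ i) x).det ≠ 0)) ∧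
      (∀ i, Ψ i '' Set.pi Set.univ (fun _ : Fin (d + 1) => Set.Ioo (0:ℝ) 1) ⊆ B) ∧
      Pairwise (fun i i' => Disjoint (Ψ i '' Set.pi Set.univ (fun _ : Fin (d + 1) => Set.Ioo (0:ℝ) 1))
        (Ψ i' '' Set.pi Set.univ (fun _ : Fin (d + 1) => Set.Ioo (0:ℝ) 1))) ∧
      (∀ i, Ψ i '' Set.pi Set.univ (fun _ : Fin (d + 1) => Set.Ioo (0:ℝ) 1) ⊆
        Sh '' {u | Fin.init u ∈ χ '' Set.pi Set.univ (fun _ : Fin d => Ioo (0 : ℝ) 1)}) ∧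
      volume Nz = 0 ∧
      (∀ z, Sh z ∈ B → Fin.init z ∈ χ '' Set.pi Set.univ (fun _ : Fin d => Ioo (0 : ℝ) 1) →
        Sh z ∈ (⋃ i, Ψ i '' Set.pi Set.univ (fun _ : Fin (d + 1) => Set.Ioo (0:ℝ) 1)) ∨ z ∈ Nz) ∧
      ∀ i j, ∃ U : Set (Fin (d + 1) → ℝ), IsOpen U ∧ Set.pi Set.univ (fun _ : Fin (d + 1) => Set.Icc (0:ℝ) 1) ⊆ U ∧
        ∃ (a₀ b₀ : Fin (d + 1) → ℕ) (e₀ : (Fin (d + 1) → ℝ) → ℝ) (L₁ L₂ : ℕ) (m₁ : Fin L₁ → ℕ)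
          (a₁ b₁ a₂ b₂ : Fin L₁ → Fin (d + 1) → ℕ) (e₁ e₂ : Fin L₁ → (Fin (d + 1) → ℝ) → ℝ)
          (m₂ : Fin L₂ → ℕ) (a₃ b₃ a₄ b₄ a₅ b₅ : Fin L₂ → Fin (d + 1) → ℕ)
          (e₃ e₄ e₅ : Fin L₂ → (Fin (d + 1) → ℝ) → ℝ),
          AnalyticOnNhd ℝ e₀ U ∧ (∀ x ∈ U, e₀ x ≠ 0) ∧
          (∀ l, AnalyticOnNhd ℝ (e₁ l) U ∧ AnalyticOnNhd ℝ (e₂ l) U ∧ ∀ x ∈ U, 0 < e₁ l x ∧ 0 < e₂ l x) ∧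
          (∀ l, AnalyticOnNhd ℝ (e₃ l) U ∧ AnalyticOnNhd ℝ (e₄ l) U ∧ AnalyticOnNhd ℝ (e₅ l) U ∧
            ∀ x ∈ U, 0 < e₃ l x ∧ 0 < e₄ l x ∧ 0 < e₅ l x) ∧
          ∀ x ∈ U, (fun x => MvPolynomial.aeval (Ψ i x) (Q j)) x =
            (∏ i, x i ^ a₀ i * (1 - x i) ^ b₀ i) * e₀ x *
              (∏ l, ((∏ i, x i ^ a₁ l i * (1 - x i) ^ b₁ l i) * e₁ l x +
                (∏ i, x i ^ a₂ l i * (1 - x i) ^ b₂ l i) * e₂ l x) ^ m₁ l) *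
              ∏ l, (((∏ i, x i ^ a₃ l i * (1 - x i) ^ b₃ l i) * e₃ l x +
                (∏ i, x i ^ a₄ l i * (1 - x i) ^ b₄ l i) * e₄ l x) ^ 2 +
                (∏ i, x i ^ a₅ l i * (1 - x i) ^ b₅ l i) * e₅ l x) ^ m₂ l := by
  classical
  set Ω := Set.pi Set.univ (fun _ : Fin d => Ioo (0 : ℝ) 1) with hΩ
  set Ω1 := Set.pi Set.univ (fun _ : Fin (d + 1) => Ioo (0 : ℝ) 1) with hΩ1
  -- ### base chart, root structure, root differences
  obtain ⟨N, δ, χ, ζ, α, E, hN, hδ, hχ, hformat, hχa, hζa, hfacP, hinj, hEa, hE0, hdisc⟩ :=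
    exists_base_chart hAJ hP hn hD φ hφa hφs hφi hφd hU₀ hcubeU₀ a b he₀ he₀0 hDφ c
  obtain ⟨τ, p, r, e, hτinv, hτ, hrinj, hrfix, hrsurj, hmono, hiff, he, -, hwall⟩ :=
    exists_root_structure hδ hRh hM hMP χ hχa ζ hζa hfacP hinj
  obtain ⟨δ', hδ', hδ'δ, hdiff, him⟩ := exists_root_differences hDIV hδ ζ hζa hτ hrinj hrfix hmono hEa hE0 hdisc
  set Bx := Set.pi Set.univ (fun _ : Fin d => Ioo (-δ) (1 + δ)) with hBx
  have hΩB : Ω ⊆ Bx := pi_Ioo_subset_box hδ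
  -- ### walls
  set W : Fin p → (Fin d → ℝ) → ℝ := fun m σ => (ζ (r m) σ).re with hW
  have hWa : ∀ m, AnalyticOnNhd ℝ (W m) Bx := fun m => analyticOnNhd_re (hζa _)
  have hWc : ∀ m, ContinuousOn (W m) Ω := fun m => (hWa m).continuousOn.mono hΩB
  have hχc : ContinuousOn χ Ω := hχa.continuousOn.mono hΩB
  have hWmono : ∀ σ ∈ Ω, StrictMono fun m => W m σ := hmono
  -- ### the root relation
  obtain ⟨q, hq⟩ := exists_mvPolynomial_of_polynomial P
  have hWroots : ∀ σ ∈ Ω, ∀ t : ℝ,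
      MvPolynomial.aeval (Fin.snoc (χ σ) t : Fin (d + 1) → ℝ) q = 0 ↔ ∃ m, t = W m σ := by
    intro σ hσ t
    rw [hq, Fin.init_snoc, Fin.snoc_last, eval_map_eq_zero_iff (hfacP σ (hΩB hσ)), hiff σ hσ]
  have hroots : ∀ qq : Ps, (qq : MvPolynomial (Fin (d + 1)) ℚ) ≠ 0 → ∀ σ ∈ Ω, ∀ t : ℝ,
      MvPolynomial.aeval (Sh (Fin.snoc (χ σ) t)) (qq : MvPolynomial (Fin (d + 1)) ℚ) = 0 → ∃ m, t = W m σ := by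
    intro qq hqq σ hσ t ht
    rw [hPeval qq _ hqq, Fin.init_snoc, Fin.snoc_last, mul_eq_zero] at ht
    rcases ht with h0 | h0
    · exact absurd h0 (by simpa using (hPh qq hqq).1)
    · have h1 := eval_eq_zero_of_dvd_of_eval_eq_zero
        (Polynomial.map_dvd (MvPolynomial.eval₂Hom (algebraMap ℚ ℝ) (χ σ)) (hPh qq hqq).2.2) h0
      rw [← Complex.ofReal_eq_zero, ofReal_eval_map, he σ (hΩB hσ), eval_prod, Finset.prod_eq_zero_iff] at h1
      obtain ⟨l, -, hl⟩ := h1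
      rw [eval_pow] at hl
      have hl' : (t : ℂ) = ζ l σ := by simpa [sub_eq_zero] using (pow_eq_zero_iff'.1 hl).1
      exact (hiff σ hσ t).1 ⟨l, hl'⟩
  -- ### the shear
  obtain ⟨TSh, hTSh⟩ := exists_shear_continuousLinearEquiv v
  have hShT : Sh = TSh := funext fun z => (hSh z).trans (hTSh z).symm
  have hShc : Continuous Sh := by rw [hShT]; exact TSh.continuous
  have hShi : Function.Injective Sh := by rw [hShT]; exact TSh.injective
  -- ### bands and the index set of the slab charts
  set Band : Fin (p + 1) → Set (Fin (d + 1) → ℝ) := fun j =>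
    {u | ∃ σ ∈ Ω, Fin.init u = χ σ ∧ bandLower W j σ < (u (Fin.last d) : EReal) ∧
      (u (Fin.last d) : EReal) < bandUpper W j σ} with hBand
  set J := {j : Fin (p + 1) // j ≠ 0 ∧ j ≠ Fin.last p ∧ Sh '' Band j ⊆ B} with hJ
  have hKJ : ∀ jj : J, ((jj.1 : ℕ) - 1) + 1 < p := fun jj => by
    have h1 : (jj.1 : ℕ) ≠ 0 := fun h => jj.2.1 (Fin.ext h)
    have h2 : (jj.1 : ℕ) ≠ p := fun h => jj.2.2.1 (Fin.ext h)
    have h3 := jj.1.2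
    omega
  have hpred : ∀ jj : J, jj.1.pred jj.2.1 = ⟨(jj.1 : ℕ) - 1, Nat.lt_of_succ_lt (hKJ jj)⟩ := fun jj =>
    Fin.ext (by simp)
  have hcastPred : ∀ jj : J, jj.1.castPred jj.2.2.1 = ⟨(jj.1 : ℕ) - 1 + 1, hKJ jj⟩ := fun jj =>
    Fin.ext (by
      have h1 : (jj.1 : ℕ) ≠ 0 := fun h => jj.2.1 (Fin.ext h)
      simp only [Fin.coe_castPred]
      omega)
  set Ψ₀ : J → (Fin (d + 1) → ℝ) → (Fin (d + 1) → ℝ) := fun jj z =>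
    Sh (Fin.snoc (χ (Fin.init z)) (W ⟨(jj.1 : ℕ) - 1, Nat.lt_of_succ_lt (hKJ jj)⟩ (Fin.init z) +
      z (Fin.last d) * (W ⟨(jj.1 : ℕ) - 1 + 1, hKJ jj⟩ (Fin.init z) -
        W ⟨(jj.1 : ℕ) - 1, Nat.lt_of_succ_lt (hKJ jj)⟩ (Fin.init z)))) with hΨ₀
  have hslab : ∀ jj : J, (AnalyticOnNhd ℝ (Ψ₀ jj) (Set.pi Set.univ (fun _ : Fin (d + 1) => Icc (0 : ℝ) 1)) ∧
      IsSemialgebraicMapOn ℚ Ω1 (Ψ₀ jj) ∧ InjOn (Ψ₀ jj) Ω1 ∧ ∀ z ∈ Ω1, (fderiv ℝ (Ψ₀ jj) z).det ≠ 0) ∧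
      Ψ₀ jj '' Ω1 = Sh '' Band jj.1 := by
    intro jj
    obtain ⟨hf, himg⟩ := slabChart_sheared_format hδ χ hχa hformat.2.1 hformat.2.2.1 hformat.2.2.2 W hWa
      hWmono q hWroots v (hKJ jj) (Ψ₀ jj) (fun z => by simp only [hΨ₀, hSh, Fin.snoc_castSucc, Fin.snoc_last])
    refine ⟨hf, ?_⟩
    rw [himg, ← show Sh = _ from funext hSh]
    congr 1
    ext u
    simp only [hBand, mem_setOf_eq, bandLower_of_ne_zero W _ jj.2.1, bandUpper_of_ne_last W _ jj.2.2.1,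
      EReal.coe_lt_coe_iff, mem_Ioo, hpred, hcastPred, hΩ]
  set Nc := Fintype.card J with hNc
  set eJ : J ≃ Fin Nc := Fintype.equivFin J with heJ
  set Ψ : Fin Nc → (Fin (d + 1) → ℝ) → (Fin (d + 1) → ℝ) := fun i => Ψ₀ (eJ.symm i) with hΨ
  -- ### the null set of wall graphs
  set Nz : Set (Fin (d + 1) → ℝ) := ⋃ m : Fin p, {u | ∃ σ ∈ Ω, Fin.init u = χ σ ∧ u (Fin.last d) = W m σ}
    with hNz
  have hNz0 : volume Nz = 0 := by
    refine measure_iUnion_null fun m => volume_wallGraph_eq_zero (fun σ hσ => (hχa σ (hΩB hσ)).differentiableAt)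
      (fun σ hσ => (hWa m σ (hΩB hσ)).differentiableAt)
  -- ### disjointness of distinct bands
  have hBdisj : ∀ j j' : Fin (p + 1), j ≠ j' → Disjoint (Band j) (Band j') := by
    intro j j' hjj'
    refine Set.disjoint_left.2 fun u ⟨σ, hσ, hinit, hb⟩ ⟨σ', hσ', hinit', hb'⟩ => hjj' ?_
    have hσσ' : σ = σ' := hformat.2.2.1 hσ hσ' (hinit.symm.trans hinit')
    subst hσσ'
    exact band_eq_band W σ (hWmono σ hσ) hb hb'
  refine ⟨N, χ, Nc, Ψ, Nz, hN, hχ, hformat.2.2.1, fun i => (hslab _).1, fun i => ?_, fun i i' hii' => ?_,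
    fun i => ?_, hNz0, fun z hzB hzχ => ?_, fun i j => ?_⟩
  · rw [hΨ]
    simp only
    rw [(hslab _).2]
    exact (eJ.symm i).2.2.2
  · simp only [hΨ]
    rw [(hslab _).2, (hslab _).2]
    refine Set.disjoint_image_of_injective hShi (hBdisj _ _ fun h => hii' ?_)
    exact eJ.symm.injective (Subtype.ext h)
  · simp only [hΨ]
    rw [(hslab _).2]
    refine Set.image_mono ?_
    rintro u ⟨σ, hσ, hinit, -⟩
    exact ⟨σ, hσ, hinit.symm⟩
  · obtain ⟨σ, hσ, hσz⟩ := hzχ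
    rcases exists_wall_or_band_of_mem hB Sh hShc hbdd hχc hWc hWmono hroots hzB hσ hσz.symm with
      ⟨m, hm⟩ | ⟨j, hj0, hjl, hlo, hhi, hsub⟩
    · exact Or.inr (mem_iUnion.2 ⟨m, σ, hσ, hσz.symm, hm⟩)
    · refine Or.inl (mem_iUnion.2 ⟨eJ ⟨j, hj0, hjl, hsub⟩, ?_⟩)
      simp only [hΨ, Equiv.symm_apply_apply]
      rw [(hslab _).2]
      refine ⟨z, ⟨σ, hσ, hσz.symm, ?_, ?_⟩, rfl⟩
      · rw [bandLower_of_ne_zero W j hj0, EReal.coe_lt_coe_iff]; exact hlo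
      · rw [bandUpper_of_ne_last W j hjl, EReal.coe_lt_coe_iff]; exact hhi
  · exact exists_factor_clause hδ hδ' hδ'δ hRh (hQh j).1 (hQh j).2 χ hχa ζ hζa hinj hτinv hτ hrinj hrfix hrsurj
      he hwall hdiff him (hκ j) Sh (hQeval j) (hKJ (eJ.symm i)) (Ψ i) (fun z => by simp only [hΨ, hΨ₀, hW])

end Literature.NumberTheory.Transcendental.JungPreparation
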